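import Summits.ABC.IUTFork.Repair.RHSigmaCellCredit
import Summits.ABC.IUTFork.Repair.RHSigmaSlackAdapter
import Summits.ABC.IUTFork.Conditional.AbcExpOfCor312SlackContent
import HarnessLib

/-!
# R-H ROUND 3, EXPONENT ENDS of the partial-credit / weighted / signed-remainder doors: «cell-level law c_j(w) with kept mass ≥ μ₀·M − Tol on the content
# locus ∧ hregC ⟹ [IUTchIV] Thm. 1.10's display DILATED by 1/μ₀ at every admissible (P, l)» (abc-iut-rh2-q2-cond's F4½ door, [NUMΣ-C] DISCHARGED)

abc-iut cell, rung LADDER-ABC:A2.RESCUE.H, R-H seat abc-iut-rh2-q2-eq (gen 3). PROOF-ONLY file (0 definitions, 0 `Prop` facts, no instance, no notation):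
this seat's `RHSigmaCellCredit.lean` (p484504, THE PARTIAL-CREDIT DOOR) and `RHSigmaSlackAdapter.lean` (p484564, THE UNIVERSAL ADAPTER) composed BY NAME with
abc-iut-rh2-q2-cond gen 3's F4½ door `Conditional.Cor312Slack.thm110LegendreWith_of_cor312Slack_mu_content_hregC` ([NUMΣ-C] · [MU-C] · [CONE-C] on the content
locus ⟹ «`Thm110LegendreWith (1/μ₀)`», written out). rh-lead g2's ROUND-3 START-HERE v1.0 §2 asks every candidate card to «name the door theorem» carrying
its CELL-LEVEL law `c_j(w)` to F5/F5κ: these are the doors for laws stated as kept FRACTIONS of cell masses (next to abc-iut-rh2-T-1's licence-currency F5).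

WHAT IS TYPED (`0 < μ₀ ≤ 1`; `Tol(P,l) = Conditional.SigmaMass.tol P l = ((l+1)/4)·5·d*·l`; CHOSEN realising ideles at every genuine Θ-volume datum `T`;
`d(c)`/`t(c)` the cell deficit / trivial cost of OUR typed hull there; a DATUM-DEPENDENT weight `ω P l T : cells → ℝ`; content locus «`6·(1 + 20·d_mod/l)·
(log-diff + log-cond) + 120·d*·l < log q^{∤{2,l}}(λ)`» of abc-iut-C-cert-1; context binders `M … qData` = the column data of this seat's abc-ends, VERBATIM):
* §1 `cor312UpTo_weightedTrivialMass_of_cellCredit_chosen` — [PC] «`d(c) ≤ (1 − ω(c))·t(c)` ∀ c» ⟹ `T.negAbsLogQ ≤ T.negLogTheta + PN Σᶠ (1−ω)·t`.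
* §2 **`thm110LegendreWith_of_cellCredit_mu_content_hregC`** — explicit 3 = [PC-C] · [MU-ω-C] · [CONE-C] on the content locus: the candidate's cell-level
  law for `ω P l T`, the RELATIVE tolerance `OffSigmaTolerance (1 − μ₀) (Tol(P,l)) T (PN Σᶠ (1−ω)·t)` (⟺ KEPT ω-mass `PN Σᶠ ω·t ≥ μ₀·M(T) − Tol(P,l)`,
  `M(T) = T.gap` by abc-iut-rh2-w-1's `totalTrivialMass_chosen_eq_gap`, cf. `weightedTrivialMass_le_iff_keptMass_ge`), and `hregC` VERBATIM ⟹ for every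
  `η_prm` and every admissible `(P, l)` the `1/μ₀`-DILATED display — «`Thm110LegendreWith (1/μ₀)`» written out; [NUMΣ-C] DISCHARGED by §1; off the
  content locus NOTHING is assumed.
* §3 **`thm110LegendreWith_of_weightedDeficit_nonpos_mu_content_hregC`** — the AGGREGATE twin: [W-C] «`ω ≤ 1` and `PN Σᶠ ω·d ≤ 0`» (THE WEIGHTED DOOR).
* §4 **`thm110LegendreWith_of_signedRemainder_mu_content_hregC`** — explicit 2 = [MU-D-C] · [CONE-C], NO door hypothesis: the LEAST slack `D(T) =
  signedRemainder = R_∅(T) − C(T)` is certified at every datum (`cor312UpTo_signedRemainder_chosen`), so the ONE content binder is the relative tolerance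
  «`D(T) ≤ (1−μ₀)·T.gap + Tol(P,l)`»; every weight / stratum / minorant end is this sentence with `D(T)` MAJORISED by the device's certified slack.
NOT HERE: «`Thm110LegendreWith Λ` ⟹ `ABCWithExponent Λ`» (EXP-SPEC F1–F4, `GenEllThm21With.lean`); no `μ₀ = 1` / Tol-form `ABC` end is re-filed (the
R14 recuts stand; the [MU-·-C] binders below are RELATIVE tolerances `≤ (1−μ₀)·T.gap + Tol`, not the ∀-T constant [TOL] shape abc-iut-rh-tst-5 targets).
HONEST FRAMING: CONDITIONAL; «the dilated display follows from these hypotheses AS TYPED», nothing more; [PC-C] / [W-C] / [MU-·-C] / [CONE-C] are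
ASSUMPTION LABELS, never asserted, refutable datum by datum (whether genuine data supply kept mass `≥ μ₀·M − Tol` on the content locus for some `μ₀ > 0`
is OPEN — round 3's question); nothing here asserts that abc (with any exponent) is proved or refuted, or that [IUTchIII] Cor. 3.12 / [IUTchIV] Thm. 1.10
holds or fails at any datum, or takes a side on any author (Mochizuki / Scholze–Stix / Joshi / Dupuy–Hilado); typed ≠ proved; instantiated ≠ endorsed.
[claim: Mochizuki2012, status: disputed] [cite: Mochizuki2012, IUTchIII Cor. 3.12 p. 173–174; IUTchIV Thm. 1.10 pp. 22–31, Cor. 2.2 (ii) p. 46] [cite: DupuyHilado2025, §3.9]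
-/

noncomputable section

open Set Function NumberField IsDedekindDomain

namespace Summit.ABC.IUTFork.Repair.RH.SigmaStrataEq

open Summit.ABC.IUTFork.Thm311 Summit.ABC.IUTFork.Thm311.Real Summit.ABC.IUTFork.Cor312 Summit.ABC.IUTFork.Cor312.Setting Summit.ABC.IUTFork.Cor312Vol
  Summit.ABC.IUTFork.Cor312Prov Literature.IUT.LogThetaLattice Literature.IUT.LogVolume Literature.IUT.HodgeTheaters Literature.IUT.LogVolume.ThetaData
  Literature.NumberTheory.DiophantineGeometry.GenEll Summit.ABC.ABC.Theorems Summit.ABC.IUTFork.Repair.RH.SigmaLicence Summit.ABC.IUTFork.Repair.RH.SigmaMass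
  Summit.ABC.IUTFork.Conditional

/-! ## §1. Partial credit at the datum (chosen realising ideles) -/

section Datum
/-- **PARTIAL CREDIT AT THE DATUM**: at the chosen bed of `T`, [PC] «`d(c) ≤ (1 − ω(c))·t(c)` at every cell» gives `T.negAbsLogQ ≤ T.negLogTheta +
weightedTrivialMass (setting) ω` (`statementUpTo_weightedTrivialMass_of_cellCredit` ∘ `cor312UpTo_of_statementUpTo_chosen`) — q2-cond's [NUMΣ-C] binder with
`ε := PN Σᶠ (1−ω)·t`. «holds AS TYPED»; [PC] is an assumption shape; no side taken. [cite: Mochizuki2012, IUTchIII Cor. 3.12 p. 173–174] [claim: Mochizuki2012, status: disputed] -/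
theorem cor312UpTo_weightedTrivialMass_of_cellCredit_chosen {P : NFPoint} {l : ℕ} (T : Cor22.ThetaVolumeDatumAt P l) :
    letI := T.instFieldF; letI := T.instNumberFieldF; letI := T.instAlgebraF; letI := T.instFieldK;
        letI := T.instNumberFieldK; letI := T.instAlgebraK; letI := T.instFieldFbar; letI := T.instAlgebraFbar;
        letI := T.instAlgebraKFbar; letI := T.instIsElliptic;
    ∀ (M : Type) [Field M] [NumberField M]
      (archPk : ∀ (j : (thetaIndex (pilotDataOfK T.D T.K)).Label) (vQ : (thetaIndex (pilotDataOfK T.D T.K)).VQ),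
        Set ((logShellsDH (pilotDataOfK T.D T.K) (analyticLogv T.K)).Packet j vQ))
      (archSub : ∀ (j : (thetaIndex (pilotDataOfK T.D T.K)).Label) (v : (thetaIndex (pilotDataOfK T.D T.K)).V),
        Set ((logShellsDH (pilotDataOfK T.D T.K) (analyticLogv T.K)).Packet j ((thetaIndex (pilotDataOfK T.D T.K)).over v)))
      (Ψ : ℤ → ∀ v : (thetaIndex (pilotDataOfK T.D T.K)).V, v ∈ (thetaIndex (pilotDataOfK T.D T.K)).Vbad →
        Set ((logShellsDH (pilotDataOfK T.D T.K) (analyticLogv T.K)).StarPacket v))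
      (act : ℤ → ∀ v : (thetaIndex (pilotDataOfK T.D T.K)).V, v ∈ (thetaIndex (pilotDataOfK T.D T.K)).Vbad →
        (logShellsDH (pilotDataOfK T.D T.K) (analyticLogv T.K)).StarPacket v →
          Module.End ℚ ((logShellsDH (pilotDataOfK T.D T.K) (analyticLogv T.K)).StarPacket v))
      (Mmod : ℤ → ∀ j : (thetaIndex (pilotDataOfK T.D T.K)).LabelStar,
        Set ((logShellsDH (pilotDataOfK T.D T.K) (analyticLogv T.K)).GlobalPacket j.1))
      (region : ℤ → ∀ j : (thetaIndex (pilotDataOfK T.D T.K)).LabelStar, FinDivisor M →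
        ∀ vQ : (thetaIndex (pilotDataOfK T.D T.K)).VQ, Set ((logShellsDH (pilotDataOfK T.D T.K) (analyticLogv T.K)).Packet j.1 vQ))
      (n : ℤ) {HT : Type} {LogLink : HT → HT → Type} {IsFull : ∀ {s t : HT}, LogLink s t → Prop}
      (lat : LGPGaussianLogThetaLattice LogLink IsFull)
      {Frd : Type} {IsoF : Frd → Frd → Type} {Ob : Frd → Type} {realify : Frd → Frd} {Strip : Type}
      {IsoS : Strip → Strip → Type}
      {Mv : ∀ v : (thetaIndex (pilotDataOfK T.D T.K)).V, v ∈ (thetaIndex (pilotDataOfK T.D T.K)).Vbad → Type}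
      [∀ v h, Monoid (Mv v h)]
      (sig : GlobalLGPFrobenioidSignature (thetaIndex (pilotDataOfK T.D T.K)).lstar (thetaIndex (pilotDataOfK T.D T.K)).V
        (· ∈ (thetaIndex (pilotDataOfK T.D T.K)).Vbad) Frd IsoF Ob realify Strip IsoS Mv)
      (split : SplittingMonoids Mv) {ObΔ : Type}
      {N : ∀ v : (thetaIndex (pilotDataOfK T.D T.K)).V, v ∈ (thetaIndex (pilotDataOfK T.D T.K)).Vbad → Type} [∀ v h, Monoid (N v h)]
      (qData : QPilotData ObΔ N)
      (ω : Fin (thetaIndex (pilotDataOfK T.D T.K)).lstar × (thetaIndex (pilotDataOfK T.D T.K)).VQ → ℝ),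
      (∀ c : Fin (thetaIndex (pilotDataOfK T.D T.K)).lstar × (thetaIndex (pilotDataOfK T.D T.K)).VQ,
        cellDeficit (settingPrVolSharp (pilotDataOfK T.D T.K) (logvAnalytic_analyticLogv (F := T.K)) M archPk archSub Ψ act Mmod region n lat
            sig split qData (exists_realising_qIdeles_pilotDataOfK T.D).choose (exists_realising_thetaIdeles_pilotDataOfK T.D).choose
            (exists_realising_qIdeles_pilotDataOfK T.D).choose_spec.1 (exists_realising_qIdeles_pilotDataOfK T.D).choose_spec.2.1) c.1 c.2 ≤
          (1 - ω c) * cellTrivialCost (settingPrVolSharp (pilotDataOfK T.D T.K) (logvAnalytic_analyticLogv (F := T.K)) M archPk archSub Ψ act Mmod region n lat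
            sig split qData (exists_realising_qIdeles_pilotDataOfK T.D).choose (exists_realising_thetaIdeles_pilotDataOfK T.D).choose
            (exists_realising_qIdeles_pilotDataOfK T.D).choose_spec.1 (exists_realising_qIdeles_pilotDataOfK T.D).choose_spec.2.1) c) →
      T.negAbsLogQ ≤ T.negLogTheta +
        weightedTrivialMass (settingPrVolSharp (pilotDataOfK T.D T.K) (logvAnalytic_analyticLogv (F := T.K)) M archPk archSub Ψ act Mmod region n lat
            sig split qData (exists_realising_qIdeles_pilotDataOfK T.D).choose (exists_realising_thetaIdeles_pilotDataOfK T.D).choose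
            (exists_realising_qIdeles_pilotDataOfK T.D).choose_spec.1 (exists_realising_qIdeles_pilotDataOfK T.D).choose_spec.2.1) ω := by
  intro M _ _ archPk archSub Ψ act Mmod region n HT LogLink IsFull lat Frd IsoF Ob realify Strip IsoS Mv _ sig split ObΔ N _ qData ω hω
  letI := T.instFieldF; letI := T.instNumberFieldF; letI := T.instAlgebraF; letI := T.instFieldK
  letI := T.instNumberFieldK; letI := T.instAlgebraK; letI := T.instFieldFbar; letI := T.instAlgebraFbar
  letI := T.instAlgebraKFbar; letI := T.instIsElliptic
  have H := bridgeHyps_settingPrVolSharp_of_ideles (pilotDataOfK T.D T.K) (logvAnalytic_analyticLogv (F := T.K)) M archPk archSub Ψ act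
    Mmod region n lat sig split qData (exists_realising_thetaIdeles_pilotDataOfK T.D).choose (exists_realising_qIdeles_pilotDataOfK T.D).choose
    (exists_realising_thetaIdeles_pilotDataOfK T.D).choose_spec.1 (exists_realising_thetaIdeles_pilotDataOfK T.D).choose_spec.2.1
    (exists_realising_qIdeles_pilotDataOfK T.D).choose_spec.1 (exists_realising_qIdeles_pilotDataOfK T.D).choose_spec.2.1
  exact cor312UpTo_of_statementUpTo_chosen T M archPk archSub Ψ act Mmod region n lat sig split qData _
    (statementUpTo_weightedTrivialMass_of_cellCredit H hω)

end Datum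
/-! ## §2–§4. The exponent ends through abc-iut-rh2-q2-cond's F4½ door (context binders once for the three theorems) -/

section Ends
variable
    (M : ∀ (P : NFPoint) (l : ℕ) (T : Cor22.ThetaVolumeDatumAt P l), Type) [∀ P l T, Field (M P l T)] [∀ P l T, NumberField (M P l T)]
    (archPk : ∀ (P : NFPoint) (l : ℕ) (T : Cor22.ThetaVolumeDatumAt P l), letI := T.instFieldF; letI := T.instNumberFieldF; letI := T.instAlgebraF; letI := T.instFieldK;
        letI := T.instNumberFieldK; letI := T.instAlgebraK; letI := T.instFieldFbar; letI := T.instAlgebraFbar;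
        letI := T.instAlgebraKFbar; letI := T.instIsElliptic;
      ∀ (j : (thetaIndex (pilotDataOfK T.D T.K)).Label) (vQ : (thetaIndex (pilotDataOfK T.D T.K)).VQ), Set ((logShellsDH (pilotDataOfK T.D T.K) (analyticLogv T.K)).Packet j vQ))
    (archSub : ∀ (P : NFPoint) (l : ℕ) (T : Cor22.ThetaVolumeDatumAt P l), letI := T.instFieldF; letI := T.instNumberFieldF; letI := T.instAlgebraF; letI := T.instFieldK;
        letI := T.instNumberFieldK; letI := T.instAlgebraK; letI := T.instFieldFbar; letI := T.instAlgebraFbar;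
        letI := T.instAlgebraKFbar; letI := T.instIsElliptic;
      ∀ (j : (thetaIndex (pilotDataOfK T.D T.K)).Label) (v : (thetaIndex (pilotDataOfK T.D T.K)).V), Set ((logShellsDH (pilotDataOfK T.D T.K) (analyticLogv T.K)).Packet j ((thetaIndex (pilotDataOfK T.D T.K)).over v)))
    (Ψ : ∀ (P : NFPoint) (l : ℕ) (T : Cor22.ThetaVolumeDatumAt P l), letI := T.instFieldF; letI := T.instNumberFieldF; letI := T.instAlgebraF; letI := T.instFieldK;
        letI := T.instNumberFieldK; letI := T.instAlgebraK; letI := T.instFieldFbar; letI := T.instAlgebraFbar;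
        letI := T.instAlgebraKFbar; letI := T.instIsElliptic;
      ℤ → ∀ v : (thetaIndex (pilotDataOfK T.D T.K)).V, v ∈ (thetaIndex (pilotDataOfK T.D T.K)).Vbad → Set ((logShellsDH (pilotDataOfK T.D T.K) (analyticLogv T.K)).StarPacket v))
    (act : ∀ (P : NFPoint) (l : ℕ) (T : Cor22.ThetaVolumeDatumAt P l), letI := T.instFieldF; letI := T.instNumberFieldF; letI := T.instAlgebraF; letI := T.instFieldK;
        letI := T.instNumberFieldK; letI := T.instAlgebraK; letI := T.instFieldFbar; letI := T.instAlgebraFbar;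
        letI := T.instAlgebraKFbar; letI := T.instIsElliptic;
      ℤ → ∀ v : (thetaIndex (pilotDataOfK T.D T.K)).V, v ∈ (thetaIndex (pilotDataOfK T.D T.K)).Vbad → (logShellsDH (pilotDataOfK T.D T.K) (analyticLogv T.K)).StarPacket v → Module.End ℚ ((logShellsDH (pilotDataOfK T.D T.K) (analyticLogv T.K)).StarPacket v))
    (Mmod : ∀ (P : NFPoint) (l : ℕ) (T : Cor22.ThetaVolumeDatumAt P l), letI := T.instFieldF; letI := T.instNumberFieldF; letI := T.instAlgebraF; letI := T.instFieldK;
        letI := T.instNumberFieldK; letI := T.instAlgebraK; letI := T.instFieldFbar; letI := T.instAlgebraFbar;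
        letI := T.instAlgebraKFbar; letI := T.instIsElliptic;
      ℤ → ∀ j : (thetaIndex (pilotDataOfK T.D T.K)).LabelStar, Set ((logShellsDH (pilotDataOfK T.D T.K) (analyticLogv T.K)).GlobalPacket j.1))
    (region : ∀ (P : NFPoint) (l : ℕ) (T : Cor22.ThetaVolumeDatumAt P l), letI := T.instFieldF; letI := T.instNumberFieldF; letI := T.instAlgebraF; letI := T.instFieldK;
        letI := T.instNumberFieldK; letI := T.instAlgebraK; letI := T.instFieldFbar; letI := T.instAlgebraFbar;
        letI := T.instAlgebraKFbar; letI := T.instIsElliptic;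
      ℤ → ∀ j : (thetaIndex (pilotDataOfK T.D T.K)).LabelStar, FinDivisor (M P l T) → ∀ vQ : (thetaIndex (pilotDataOfK T.D T.K)).VQ, Set ((logShellsDH (pilotDataOfK T.D T.K) (analyticLogv T.K)).Packet j.1 vQ))
    (n : ∀ (P : NFPoint) (l : ℕ) (T : Cor22.ThetaVolumeDatumAt P l), ℤ)
    {HT : ∀ (P : NFPoint) (l : ℕ) (T : Cor22.ThetaVolumeDatumAt P l), Type} {LogLink : ∀ (P : NFPoint) (l : ℕ) (T : Cor22.ThetaVolumeDatumAt P l), HT P l T → HT P l T → Type}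
    {IsFull : ∀ (P : NFPoint) (l : ℕ) (T : Cor22.ThetaVolumeDatumAt P l), ∀ {s t : HT P l T}, LogLink P l T s t → Prop}
    (lat : ∀ (P : NFPoint) (l : ℕ) (T : Cor22.ThetaVolumeDatumAt P l), LGPGaussianLogThetaLattice (LogLink P l T) (IsFull P l T))
    {Frd : ∀ (P : NFPoint) (l : ℕ) (T : Cor22.ThetaVolumeDatumAt P l), Type} {IsoF : ∀ (P : NFPoint) (l : ℕ) (T : Cor22.ThetaVolumeDatumAt P l), Frd P l T → Frd P l T → Type} {Ob : ∀ (P : NFPoint) (l : ℕ) (T : Cor22.ThetaVolumeDatumAt P l), Frd P l T → Type}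
    {realify : ∀ (P : NFPoint) (l : ℕ) (T : Cor22.ThetaVolumeDatumAt P l), Frd P l T → Frd P l T} {Strip : ∀ (P : NFPoint) (l : ℕ) (T : Cor22.ThetaVolumeDatumAt P l), Type} {IsoS : ∀ (P : NFPoint) (l : ℕ) (T : Cor22.ThetaVolumeDatumAt P l), Strip P l T → Strip P l T → Type}
    {Mv : ∀ (P : NFPoint) (l : ℕ) (T : Cor22.ThetaVolumeDatumAt P l), letI := T.instFieldF; letI := T.instNumberFieldF; letI := T.instAlgebraF; letI := T.instFieldK;
        letI := T.instNumberFieldK; letI := T.instAlgebraK; letI := T.instFieldFbar; letI := T.instAlgebraFbar;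
        letI := T.instAlgebraKFbar; letI := T.instIsElliptic;
      ∀ v : (thetaIndex (pilotDataOfK T.D T.K)).V, v ∈ (thetaIndex (pilotDataOfK T.D T.K)).Vbad → Type}
    [∀ P l T v h, Monoid (Mv P l T v h)]
    (sig : ∀ (P : NFPoint) (l : ℕ) (T : Cor22.ThetaVolumeDatumAt P l), letI := T.instFieldF; letI := T.instNumberFieldF; letI := T.instAlgebraF; letI := T.instFieldK;
        letI := T.instNumberFieldK; letI := T.instAlgebraK; letI := T.instFieldFbar; letI := T.instAlgebraFbar;
        letI := T.instAlgebraKFbar; letI := T.instIsElliptic;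
      GlobalLGPFrobenioidSignature (thetaIndex (pilotDataOfK T.D T.K)).lstar (thetaIndex (pilotDataOfK T.D T.K)).V (· ∈ (thetaIndex (pilotDataOfK T.D T.K)).Vbad) (Frd P l T) (IsoF P l T) (Ob P l T) (realify P l T)
        (Strip P l T) (IsoS P l T) (Mv P l T))
    (split : ∀ (P : NFPoint) (l : ℕ) (T : Cor22.ThetaVolumeDatumAt P l), SplittingMonoids (Mv P l T))
    {ObΔ : ∀ (P : NFPoint) (l : ℕ) (T : Cor22.ThetaVolumeDatumAt P l), Type} {N : ∀ (P : NFPoint) (l : ℕ) (T : Cor22.ThetaVolumeDatumAt P l), letI := T.instFieldF; letI := T.instNumberFieldF; letI := T.instAlgebraF; letI := T.instFieldK;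
        letI := T.instNumberFieldK; letI := T.instAlgebraK; letI := T.instFieldFbar; letI := T.instAlgebraFbar;
        letI := T.instAlgebraKFbar; letI := T.instIsElliptic;
      ∀ v : (thetaIndex (pilotDataOfK T.D T.K)).V, v ∈ (thetaIndex (pilotDataOfK T.D T.K)).Vbad → Type}
    [∀ P l T v h, Monoid (N P l T v h)] (qData : ∀ (P : NFPoint) (l : ℕ) (T : Cor22.ThetaVolumeDatumAt P l), QPilotData (ObΔ P l T) (N P l T))

include M archPk archSub Ψ act Mmod region n lat sig split qData

/-- **`thm110LegendreWith_of_cellCredit_mu_content_hregC` — THE PARTIAL-CREDIT EXPONENT END** (`0 < μ₀ ≤ 1`). Explicit 3 = [PC-C] 1 · [MU-ω-C] 1 ·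
[CONE-C] 1, for a datum-dependent weight `ω P l T` on the cells of the chosen bed: IF on the content locus, at every genuine Θ-volume datum `T` of every
admissible `(P, l)`, [PC-C] «`cellDeficit(c) ≤ (1 − ω(c))·cellTrivialCost(c)` at every cell `c`» (the candidate's CELL-LEVEL law, ROUND-3 START-HERE §0:
`ω(c) = c_j(w)` the certified fraction of the cell's `(j²−1)`-mass), [MU-ω-C] `OffSigmaTolerance (1 − μ₀) (Tol(P,l)) T (weightedTrivialMass … ω)` (the charged
mass `PN Σᶠ (1−ω)·t ≤ (1−μ₀)·T.gap + Tol(P,l)` ⟺ kept ω-mass `≥ μ₀·T.gap − Tol`), [CONE-C] `hregC` VERBATIM — THEN «`Thm110LegendreWith (1/μ₀)`» (written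
out; q2-cond's `Cor312Slack.thm110LegendreWith_of_cor312Slack_mu_content_hregC` with `ε P l T := weightedTrivialMass … (ω P l T)`, [NUMΣ-C] DISCHARGED by §1).
CONDITIONAL; no side taken. [cite: Mochizuki2012, IUTchIV Thm. 1.10 pp. 22–31; Cor. 2.2 (ii) p. 46; IUTchIII Cor. 3.12 p. 174] [claim: Mochizuki2012, status: disputed] -/
theorem thm110LegendreWith_of_cellCredit_mu_content_hregC (μ₀ : ℝ) (hμ₀ : 0 < μ₀) (hμ₁ : μ₀ ≤ 1)
    (ω : ∀ (P : NFPoint) (l : ℕ) (T : Cor22.ThetaVolumeDatumAt P l), letI := T.instFieldF; letI := T.instNumberFieldF; letI := T.instAlgebraF; letI := T.instFieldK;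
        letI := T.instNumberFieldK; letI := T.instAlgebraK; letI := T.instFieldFbar; letI := T.instAlgebraFbar;
        letI := T.instAlgebraKFbar; letI := T.instIsElliptic;
      Fin (thetaIndex (pilotDataOfK T.D T.K)).lstar × (thetaIndex (pilotDataOfK T.D T.K)).VQ → ℝ)
    -- [PC-C] the candidate's CELL-LEVEL law at the chosen bed, demanded ONLY on the content locus
    (hPCC : ∀ P : NFPoint, P ∈ UP → ∀ l : ℕ, l.Prime → 5 ≤ l →
      Cor22.AdmitsCore P → Cor22.CondP2 P l → Cor22.CondP5 P l → Cor22.CondP6 P l →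
      6 * ((1 + 20 * (Cor22.dmod P : ℝ) / l) * (P.logDiff + Cor22.logCondAvoid P {2, l}))
          + 120 * (2 ^ 12 * 3 ^ 3 * 5 * (Cor22.dmod P : ℝ) * l) < Cor22.logQAvoid P {2, l} →
      ∀ T : Cor22.ThetaVolumeDatumAt P l, letI := T.instFieldF; letI := T.instNumberFieldF; letI := T.instAlgebraF; letI := T.instFieldK;
        letI := T.instNumberFieldK; letI := T.instAlgebraK; letI := T.instFieldFbar; letI := T.instAlgebraFbar;
        letI := T.instAlgebraKFbar; letI := T.instIsElliptic;
      ∀ c : Fin (thetaIndex (pilotDataOfK T.D T.K)).lstar × (thetaIndex (pilotDataOfK T.D T.K)).VQ,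
        cellDeficit
          (settingPrVolSharp (pilotDataOfK T.D T.K) (logvAnalytic_analyticLogv (F := T.K)) (M P l T) (archPk P l T) (archSub P l T) (Ψ P l T)
            (act P l T) (Mmod P l T) (region P l T) (n P l T) (lat P l T) (sig P l T) (split P l T) (qData P l T)
            (exists_realising_qIdeles_pilotDataOfK T.D).choose
            (exists_realising_thetaIdeles_pilotDataOfK T.D).choose
            (exists_realising_qIdeles_pilotDataOfK T.D).choose_spec.1
            (exists_realising_qIdeles_pilotDataOfK T.D).choose_spec.2.1) c.1 c.2 ≤
        (1 - ω P l T c) *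
          cellTrivialCost
            (settingPrVolSharp (pilotDataOfK T.D T.K) (logvAnalytic_analyticLogv (F := T.K)) (M P l T) (archPk P l T) (archSub P l T) (Ψ P l T)
            (act P l T) (Mmod P l T) (region P l T) (n P l T) (lat P l T) (sig P l T) (split P l T) (qData P l T)
            (exists_realising_qIdeles_pilotDataOfK T.D).choose
            (exists_realising_thetaIdeles_pilotDataOfK T.D).choose
            (exists_realising_qIdeles_pilotDataOfK T.D).choose_spec.1
            (exists_realising_qIdeles_pilotDataOfK T.D).choose_spec.2.1) c)
    -- [MU-ω-C] the charged mass is within the RELATIVE tolerance `(1 − μ₀)·T.gap + Tol(P,l)`, demanded ONLY there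
    (hMuC : ∀ P : NFPoint, P ∈ UP → ∀ l : ℕ, l.Prime → 5 ≤ l →
      Cor22.AdmitsCore P → Cor22.CondP2 P l → Cor22.CondP5 P l → Cor22.CondP6 P l →
      6 * ((1 + 20 * (Cor22.dmod P : ℝ) / l) * (P.logDiff + Cor22.logCondAvoid P {2, l}))
          + 120 * (2 ^ 12 * 3 ^ 3 * 5 * (Cor22.dmod P : ℝ) * l) < Cor22.logQAvoid P {2, l} →
      ∀ T : Cor22.ThetaVolumeDatumAt P l, letI := T.instFieldF; letI := T.instNumberFieldF; letI := T.instAlgebraF; letI := T.instFieldK;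
        letI := T.instNumberFieldK; letI := T.instAlgebraK; letI := T.instFieldFbar; letI := T.instAlgebraFbar;
        letI := T.instAlgebraKFbar; letI := T.instIsElliptic;
      RH.OffSigma.OffSigmaTolerance (1 - μ₀) (Conditional.SigmaMass.tol P l) T
        (weightedTrivialMass
          (settingPrVolSharp (pilotDataOfK T.D T.K) (logvAnalytic_analyticLogv (F := T.K)) (M P l T) (archPk P l T) (archSub P l T) (Ψ P l T)
            (act P l T) (Mmod P l T) (region P l T) (n P l T) (lat P l T) (sig P l T) (split P l T) (qData P l T)
            (exists_realising_qIdeles_pilotDataOfK T.D).choose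
            (exists_realising_thetaIdeles_pilotDataOfK T.D).choose
            (exists_realising_qIdeles_pilotDataOfK T.D).choose_spec.1
            (exists_realising_qIdeles_pilotDataOfK T.D).choose_spec.2.1) (ω P l T)))
    -- [CONE-C] abc-iut-C-cert-1's `hregC` VERBATIM (the off-regime hull estimate with print's `B_III(P,l)`, ONLY on the content locus)
    (hregC : ∀ P : NFPoint, P ∈ UP → ∀ l : ℕ, l.Prime → 5 ≤ l →
      Cor22.AdmitsCore P → Cor22.CondP2 P l → Cor22.CondP5 P l → Cor22.CondP6 P l →
      6 * ((1 + 20 * (Cor22.dmod P : ℝ) / l) * (P.logDiff + Cor22.logCondAvoid P {2, l}))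
          + 120 * (2 ^ 12 * 3 ^ 3 * 5 * (Cor22.dmod P : ℝ) * l) < Cor22.logQAvoid P {2, l} →
      ∀ T : Cor22.ThetaVolumeDatumAt P l,
        (letI := T.instFieldF; letI := T.instNumberFieldF; letI := T.instAlgebraF; letI := T.instFieldK
         letI := T.instNumberFieldK; letI := T.instAlgebraK; letI := T.instFieldFbar; letI := T.instAlgebraFbar
         letI := T.instAlgebraKFbar; letI := T.instIsElliptic
         ¬ (∀ p ∈ T.I.supportPrimes, ∀ v w : placesOver (fieldOfModuli T.E) p,
            (Summit.ABC.IUTFork.DHData.ofInput T.I).logQloc p v = (Summit.ABC.IUTFork.DHData.ofInput T.I).logQloc p w)) →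
        T.HullEstimateOf
          (((l : ℝ) + 1) / 4 *
            ((1 + 12 * (Cor22.dmod P : ℝ) / l) * (P.logDiff + Cor22.logCondAvoid P {2, l})
              + 2 * Real.log l + 52
              + 20 / 3 * Real.log (((2 ^ 12 * 3 ^ 3 * 5 * Cor22.dmod P : ℕ) : ℝ) * (l : ℝ))
                * (Nat.primeCounting (2 ^ 12 * 3 ^ 3 * 5 * Cor22.dmod P * l) : ℝ)))) :
    ∀ η : ℝ, IsEtaPrm η → ∀ P : NFPoint, P ∈ UP → ∀ l : ℕ, l.Prime → 5 ≤ l →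
      Cor22.AdmitsCore P → Cor22.CondP2 P l → Cor22.CondP5 P l → Cor22.CondP6 P l →
      1 / 6 * Cor22.logQAvoid P {2, l} ≤
        1 / μ₀ * ((1 + 20 * (Cor22.dmod P : ℝ) / l) * (P.logDiff + Cor22.logCondAvoid P {2, l})
          + 20 * (2 ^ 12 * 3 ^ 3 * 5 * (Cor22.dmod P : ℝ) * l + η)) :=
  Cor312Slack.thm110LegendreWith_of_cor312Slack_mu_content_hregC μ₀ hμ₀ hμ₁
    (fun P l T => letI := T.instFieldF; letI := T.instNumberFieldF; letI := T.instAlgebraF; letI := T.instFieldK;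
        letI := T.instNumberFieldK; letI := T.instAlgebraK; letI := T.instFieldFbar; letI := T.instAlgebraFbar;
        letI := T.instAlgebraKFbar; letI := T.instIsElliptic;
      weightedTrivialMass
        (settingPrVolSharp (pilotDataOfK T.D T.K) (logvAnalytic_analyticLogv (F := T.K)) (M P l T) (archPk P l T) (archSub P l T) (Ψ P l T)
            (act P l T) (Mmod P l T) (region P l T) (n P l T) (lat P l T) (sig P l T) (split P l T) (qData P l T)
            (exists_realising_qIdeles_pilotDataOfK T.D).choose
            (exists_realising_thetaIdeles_pilotDataOfK T.D).choose
            (exists_realising_qIdeles_pilotDataOfK T.D).choose_spec.1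
            (exists_realising_qIdeles_pilotDataOfK T.D).choose_spec.2.1) (ω P l T))
    (fun P hP l hl h5 hcore hP2 hP5 hP6 hct T =>
      cor312UpTo_weightedTrivialMass_of_cellCredit_chosen T (M P l T) (archPk P l T) (archSub P l T) (Ψ P l T) (act P l T) (Mmod P l T)
        (region P l T) (n P l T) (lat P l T) (sig P l T) (split P l T) (qData P l T) (ω P l T)
        (hPCC P hP l hl h5 hcore hP2 hP5 hP6 hct T))
    hMuC hregC

/-- **`thm110LegendreWith_of_weightedDeficit_nonpos_mu_content_hregC` — THE WEIGHTED (AGGREGATE) EXPONENT END** (`0 < μ₀ ≤ 1`). Explicit 3 = [W-C] 1 ·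
[MU-ω-C] 1 · [CONE-C] 1: as §2 with the cellwise law replaced by THE WEIGHTED DOOR's aggregate hypothesis (p480491) [W-C] «`ω ≤ 1` cellwise and
`weightedDeficit … ω ≤ 0` (`PN Σᶠ ω·d ≤ 0`: net ω-weighted slack `≥ 0`)» on the content locus ⟹ «`Thm110LegendreWith (1/μ₀)`» (written out); [NUMΣ-C]
DISCHARGED by `cor312UpTo_weightedTrivialMass_of_weightedDeficit_nonpos_chosen` (the generation pass's `H_ω` families in the exponent currency). CONDITIONAL;
no side taken. [cite: Mochizuki2012, IUTchIV Thm. 1.10 pp. 22–31; Cor. 2.2 (ii) p. 46; IUTchIII Cor. 3.12 p. 174] [claim: Mochizuki2012, status: disputed] -/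
theorem thm110LegendreWith_of_weightedDeficit_nonpos_mu_content_hregC (μ₀ : ℝ) (hμ₀ : 0 < μ₀) (hμ₁ : μ₀ ≤ 1)
    (ω : ∀ (P : NFPoint) (l : ℕ) (T : Cor22.ThetaVolumeDatumAt P l), letI := T.instFieldF; letI := T.instNumberFieldF; letI := T.instAlgebraF; letI := T.instFieldK;
        letI := T.instNumberFieldK; letI := T.instAlgebraK; letI := T.instFieldFbar; letI := T.instAlgebraFbar;
        letI := T.instAlgebraKFbar; letI := T.instIsElliptic;
      Fin (thetaIndex (pilotDataOfK T.D T.K)).lstar × (thetaIndex (pilotDataOfK T.D T.K)).VQ → ℝ)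
    -- [W-C] THE WEIGHTED DOOR's hypotheses at the chosen bed, demanded ONLY on the content locus
    (hWC : ∀ P : NFPoint, P ∈ UP → ∀ l : ℕ, l.Prime → 5 ≤ l →
      Cor22.AdmitsCore P → Cor22.CondP2 P l → Cor22.CondP5 P l → Cor22.CondP6 P l →
      6 * ((1 + 20 * (Cor22.dmod P : ℝ) / l) * (P.logDiff + Cor22.logCondAvoid P {2, l}))
          + 120 * (2 ^ 12 * 3 ^ 3 * 5 * (Cor22.dmod P : ℝ) * l) < Cor22.logQAvoid P {2, l} →
      ∀ T : Cor22.ThetaVolumeDatumAt P l, letI := T.instFieldF; letI := T.instNumberFieldF; letI := T.instAlgebraF; letI := T.instFieldK;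
        letI := T.instNumberFieldK; letI := T.instAlgebraK; letI := T.instFieldFbar; letI := T.instAlgebraFbar;
        letI := T.instAlgebraKFbar; letI := T.instIsElliptic;
      (∀ c : Fin (thetaIndex (pilotDataOfK T.D T.K)).lstar × (thetaIndex (pilotDataOfK T.D T.K)).VQ, ω P l T c ≤ 1) ∧
        weightedDeficit
          (settingPrVolSharp (pilotDataOfK T.D T.K) (logvAnalytic_analyticLogv (F := T.K)) (M P l T) (archPk P l T) (archSub P l T) (Ψ P l T)
            (act P l T) (Mmod P l T) (region P l T) (n P l T) (lat P l T) (sig P l T) (split P l T) (qData P l T)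
            (exists_realising_qIdeles_pilotDataOfK T.D).choose
            (exists_realising_thetaIdeles_pilotDataOfK T.D).choose
            (exists_realising_qIdeles_pilotDataOfK T.D).choose_spec.1
            (exists_realising_qIdeles_pilotDataOfK T.D).choose_spec.2.1) (ω P l T) ≤ 0)
    -- [MU-ω-C] the charged mass is within the RELATIVE tolerance `(1 − μ₀)·T.gap + Tol(P,l)`, demanded ONLY there
    (hMuC : ∀ P : NFPoint, P ∈ UP → ∀ l : ℕ, l.Prime → 5 ≤ l →
      Cor22.AdmitsCore P → Cor22.CondP2 P l → Cor22.CondP5 P l → Cor22.CondP6 P l →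
      6 * ((1 + 20 * (Cor22.dmod P : ℝ) / l) * (P.logDiff + Cor22.logCondAvoid P {2, l}))
          + 120 * (2 ^ 12 * 3 ^ 3 * 5 * (Cor22.dmod P : ℝ) * l) < Cor22.logQAvoid P {2, l} →
      ∀ T : Cor22.ThetaVolumeDatumAt P l, letI := T.instFieldF; letI := T.instNumberFieldF; letI := T.instAlgebraF; letI := T.instFieldK;
        letI := T.instNumberFieldK; letI := T.instAlgebraK; letI := T.instFieldFbar; letI := T.instAlgebraFbar;
        letI := T.instAlgebraKFbar; letI := T.instIsElliptic;
      RH.OffSigma.OffSigmaTolerance (1 - μ₀) (Conditional.SigmaMass.tol P l) T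
        (weightedTrivialMass
          (settingPrVolSharp (pilotDataOfK T.D T.K) (logvAnalytic_analyticLogv (F := T.K)) (M P l T) (archPk P l T) (archSub P l T) (Ψ P l T)
            (act P l T) (Mmod P l T) (region P l T) (n P l T) (lat P l T) (sig P l T) (split P l T) (qData P l T)
            (exists_realising_qIdeles_pilotDataOfK T.D).choose
            (exists_realising_thetaIdeles_pilotDataOfK T.D).choose
            (exists_realising_qIdeles_pilotDataOfK T.D).choose_spec.1
            (exists_realising_qIdeles_pilotDataOfK T.D).choose_spec.2.1) (ω P l T)))
    -- [CONE-C] abc-iut-C-cert-1's `hregC` VERBATIM (the off-regime hull estimate with print's `B_III(P,l)`, ONLY on the content locus)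
    (hregC : ∀ P : NFPoint, P ∈ UP → ∀ l : ℕ, l.Prime → 5 ≤ l →
      Cor22.AdmitsCore P → Cor22.CondP2 P l → Cor22.CondP5 P l → Cor22.CondP6 P l →
      6 * ((1 + 20 * (Cor22.dmod P : ℝ) / l) * (P.logDiff + Cor22.logCondAvoid P {2, l}))
          + 120 * (2 ^ 12 * 3 ^ 3 * 5 * (Cor22.dmod P : ℝ) * l) < Cor22.logQAvoid P {2, l} →
      ∀ T : Cor22.ThetaVolumeDatumAt P l,
        (letI := T.instFieldF; letI := T.instNumberFieldF; letI := T.instAlgebraF; letI := T.instFieldK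
         letI := T.instNumberFieldK; letI := T.instAlgebraK; letI := T.instFieldFbar; letI := T.instAlgebraFbar
         letI := T.instAlgebraKFbar; letI := T.instIsElliptic
         ¬ (∀ p ∈ T.I.supportPrimes, ∀ v w : placesOver (fieldOfModuli T.E) p,
            (Summit.ABC.IUTFork.DHData.ofInput T.I).logQloc p v = (Summit.ABC.IUTFork.DHData.ofInput T.I).logQloc p w)) →
        T.HullEstimateOf
          (((l : ℝ) + 1) / 4 *
            ((1 + 12 * (Cor22.dmod P : ℝ) / l) * (P.logDiff + Cor22.logCondAvoid P {2, l})
              + 2 * Real.log l + 52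
              + 20 / 3 * Real.log (((2 ^ 12 * 3 ^ 3 * 5 * Cor22.dmod P : ℕ) : ℝ) * (l : ℝ))
                * (Nat.primeCounting (2 ^ 12 * 3 ^ 3 * 5 * Cor22.dmod P * l) : ℝ)))) :
    ∀ η : ℝ, IsEtaPrm η → ∀ P : NFPoint, P ∈ UP → ∀ l : ℕ, l.Prime → 5 ≤ l →
      Cor22.AdmitsCore P → Cor22.CondP2 P l → Cor22.CondP5 P l → Cor22.CondP6 P l →
      1 / 6 * Cor22.logQAvoid P {2, l} ≤
        1 / μ₀ * ((1 + 20 * (Cor22.dmod P : ℝ) / l) * (P.logDiff + Cor22.logCondAvoid P {2, l})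
          + 20 * (2 ^ 12 * 3 ^ 3 * 5 * (Cor22.dmod P : ℝ) * l + η)) :=
  Cor312Slack.thm110LegendreWith_of_cor312Slack_mu_content_hregC μ₀ hμ₀ hμ₁
    (fun P l T => letI := T.instFieldF; letI := T.instNumberFieldF; letI := T.instAlgebraF; letI := T.instFieldK;
        letI := T.instNumberFieldK; letI := T.instAlgebraK; letI := T.instFieldFbar; letI := T.instAlgebraFbar;
        letI := T.instAlgebraKFbar; letI := T.instIsElliptic;
      weightedTrivialMass
        (settingPrVolSharp (pilotDataOfK T.D T.K) (logvAnalytic_analyticLogv (F := T.K)) (M P l T) (archPk P l T) (archSub P l T) (Ψ P l T)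
            (act P l T) (Mmod P l T) (region P l T) (n P l T) (lat P l T) (sig P l T) (split P l T) (qData P l T)
            (exists_realising_qIdeles_pilotDataOfK T.D).choose
            (exists_realising_thetaIdeles_pilotDataOfK T.D).choose
            (exists_realising_qIdeles_pilotDataOfK T.D).choose_spec.1
            (exists_realising_qIdeles_pilotDataOfK T.D).choose_spec.2.1) (ω P l T))
    (fun P hP l hl h5 hcore hP2 hP5 hP6 hct T =>
      cor312UpTo_weightedTrivialMass_of_weightedDeficit_nonpos_chosen T (M P l T) (archPk P l T) (archSub P l T) (Ψ P l T) (act P l T) (Mmod P l T)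
        (region P l T) (n P l T) (lat P l T) (sig P l T) (split P l T) (qData P l T) (ω P l T)
        (hWC P hP l hl h5 hcore hP2 hP5 hP6 hct T).1 (hWC P hP l hl h5 hcore hP2 hP5 hP6 hct T).2)
    hMuC hregC

/-- **`thm110LegendreWith_of_signedRemainder_mu_content_hregC` — THE LEAST-SLACK EXPONENT END, NO DOOR HYPOTHESIS** (`0 < μ₀ ≤ 1`). Explicit 2 =
[MU-D-C] 1 · [CONE-C] 1: IF on the content locus, at every genuine Θ-volume datum `T` of every admissible `(P, l)`, the SIGNED remainder of OUR typed hull at the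
chosen realising ideles, `D(T) = signedRemainder … = R_∅(T) − C(T)` (p480491; the least `ε` with «Cor. 3.12 up to `ε`», p479556), is within the relative
tolerance, `OffSigmaTolerance (1 − μ₀) (Tol(P,l)) T (D(T))` («`D(T) ≤ (1−μ₀)·T.gap + Tol(P,l)`»), AND [CONE-C] `hregC` VERBATIM — THEN «`Thm110LegendreWith (1/μ₀)`»
(written out; [NUMΣ-C] DISCHARGED hypothesis-free by `cor312UpTo_signedRemainder_chosen`). Every device end is this sentence with `D(T)` majorised by the
device's certified slack. CONDITIONAL; [MU-D-C] is an assumption label on a DEFINED datum number (a RELATIVE tolerance); no side taken.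
[cite: Mochizuki2012, IUTchIV Thm. 1.10 pp. 22–31; Cor. 2.2 (ii) p. 46; IUTchIII Cor. 3.12 p. 174] [claim: Mochizuki2012, status: disputed] -/
theorem thm110LegendreWith_of_signedRemainder_mu_content_hregC (μ₀ : ℝ) (hμ₀ : 0 < μ₀) (hμ₁ : μ₀ ≤ 1)
    -- [MU-D-C] the signed remainder is within the RELATIVE tolerance `(1 − μ₀)·T.gap + Tol(P,l)`, demanded ONLY on the content locus
    (hMuDC : ∀ P : NFPoint, P ∈ UP → ∀ l : ℕ, l.Prime → 5 ≤ l →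
      Cor22.AdmitsCore P → Cor22.CondP2 P l → Cor22.CondP5 P l → Cor22.CondP6 P l →
      6 * ((1 + 20 * (Cor22.dmod P : ℝ) / l) * (P.logDiff + Cor22.logCondAvoid P {2, l}))
          + 120 * (2 ^ 12 * 3 ^ 3 * 5 * (Cor22.dmod P : ℝ) * l) < Cor22.logQAvoid P {2, l} →
      ∀ T : Cor22.ThetaVolumeDatumAt P l, letI := T.instFieldF; letI := T.instNumberFieldF; letI := T.instAlgebraF; letI := T.instFieldK;
        letI := T.instNumberFieldK; letI := T.instAlgebraK; letI := T.instFieldFbar; letI := T.instAlgebraFbar;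
        letI := T.instAlgebraKFbar; letI := T.instIsElliptic;
      RH.OffSigma.OffSigmaTolerance (1 - μ₀) (Conditional.SigmaMass.tol P l) T
        (signedRemainder
          (settingPrVolSharp (pilotDataOfK T.D T.K) (logvAnalytic_analyticLogv (F := T.K)) (M P l T) (archPk P l T) (archSub P l T) (Ψ P l T)
            (act P l T) (Mmod P l T) (region P l T) (n P l T) (lat P l T) (sig P l T) (split P l T) (qData P l T)
            (exists_realising_qIdeles_pilotDataOfK T.D).choose
            (exists_realising_thetaIdeles_pilotDataOfK T.D).choose
            (exists_realising_qIdeles_pilotDataOfK T.D).choose_spec.1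
            (exists_realising_qIdeles_pilotDataOfK T.D).choose_spec.2.1)))
    -- [CONE-C] abc-iut-C-cert-1's `hregC` VERBATIM (the off-regime hull estimate with print's `B_III(P,l)`, ONLY on the content locus)
    (hregC : ∀ P : NFPoint, P ∈ UP → ∀ l : ℕ, l.Prime → 5 ≤ l →
      Cor22.AdmitsCore P → Cor22.CondP2 P l → Cor22.CondP5 P l → Cor22.CondP6 P l →
      6 * ((1 + 20 * (Cor22.dmod P : ℝ) / l) * (P.logDiff + Cor22.logCondAvoid P {2, l}))
          + 120 * (2 ^ 12 * 3 ^ 3 * 5 * (Cor22.dmod P : ℝ) * l) < Cor22.logQAvoid P {2, l} →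
      ∀ T : Cor22.ThetaVolumeDatumAt P l,
        (letI := T.instFieldF; letI := T.instNumberFieldF; letI := T.instAlgebraF; letI := T.instFieldK
         letI := T.instNumberFieldK; letI := T.instAlgebraK; letI := T.instFieldFbar; letI := T.instAlgebraFbar
         letI := T.instAlgebraKFbar; letI := T.instIsElliptic
         ¬ (∀ p ∈ T.I.supportPrimes, ∀ v w : placesOver (fieldOfModuli T.E) p,
            (Summit.ABC.IUTFork.DHData.ofInput T.I).logQloc p v = (Summit.ABC.IUTFork.DHData.ofInput T.I).logQloc p w)) →
        T.HullEstimateOf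
          (((l : ℝ) + 1) / 4 *
            ((1 + 12 * (Cor22.dmod P : ℝ) / l) * (P.logDiff + Cor22.logCondAvoid P {2, l})
              + 2 * Real.log l + 52
              + 20 / 3 * Real.log (((2 ^ 12 * 3 ^ 3 * 5 * Cor22.dmod P : ℕ) : ℝ) * (l : ℝ))
                * (Nat.primeCounting (2 ^ 12 * 3 ^ 3 * 5 * Cor22.dmod P * l) : ℝ)))) :
    ∀ η : ℝ, IsEtaPrm η → ∀ P : NFPoint, P ∈ UP → ∀ l : ℕ, l.Prime → 5 ≤ l →
      Cor22.AdmitsCore P → Cor22.CondP2 P l → Cor22.CondP5 P l → Cor22.CondP6 P l →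
      1 / 6 * Cor22.logQAvoid P {2, l} ≤
        1 / μ₀ * ((1 + 20 * (Cor22.dmod P : ℝ) / l) * (P.logDiff + Cor22.logCondAvoid P {2, l})
          + 20 * (2 ^ 12 * 3 ^ 3 * 5 * (Cor22.dmod P : ℝ) * l + η)) :=
  Cor312Slack.thm110LegendreWith_of_cor312Slack_mu_content_hregC μ₀ hμ₀ hμ₁
    (fun P l T => letI := T.instFieldF; letI := T.instNumberFieldF; letI := T.instAlgebraF; letI := T.instFieldK;
        letI := T.instNumberFieldK; letI := T.instAlgebraK; letI := T.instFieldFbar; letI := T.instAlgebraFbar;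
        letI := T.instAlgebraKFbar; letI := T.instIsElliptic;
      signedRemainder
        (settingPrVolSharp (pilotDataOfK T.D T.K) (logvAnalytic_analyticLogv (F := T.K)) (M P l T) (archPk P l T) (archSub P l T) (Ψ P l T)
            (act P l T) (Mmod P l T) (region P l T) (n P l T) (lat P l T) (sig P l T) (split P l T) (qData P l T)
            (exists_realising_qIdeles_pilotDataOfK T.D).choose
            (exists_realising_thetaIdeles_pilotDataOfK T.D).choose
            (exists_realising_qIdeles_pilotDataOfK T.D).choose_spec.1
            (exists_realising_qIdeles_pilotDataOfK T.D).choose_spec.2.1))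
    (fun P _ l _ _ _ _ _ _ _ T =>
      cor312UpTo_signedRemainder_chosen T (M P l T) (archPk P l T) (archSub P l T) (Ψ P l T) (act P l T) (Mmod P l T)
        (region P l T) (n P l T) (lat P l T) (sig P l T) (split P l T) (qData P l T))
    hMuDC hregC

end Ends

end Summit.ABC.IUTFork.Repair.RH.SigmaStrataEq
end
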